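import Summits.Ventures.PercRepro.MSTightMergeSetup

/-!
# The merged data on `u ∪ {m}`: definitions, membership, the faces of the merged data and the
# counts (Addendum 39, Step 2 — the bookkeeping)

Dossier proofs/MINE1-theoremS.md, Addendum 39 (Step 2), and proofs/MINE1-RSTARM-PROOF.md §5 (the
merge). For an instance `RInst S L' T u` and a vertex `m ∉ u`, with `A_u = L' ∩ 2^u`,
`Λ = link U u` (the link of `ū`), `P = {y ∩ u}` the traces and `𝒬 = outFaces T u` the faces below
an outside trace, the merged data on the ground set `insert m u` is
* `mergeL S u L' m = A_u ∪ {insert m x : x ∈ Λ}`;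
* `mergeT T u m = T_u ∪ {insert m t : t ∈ P ∩ 𝒬}`.
This module holds the definitions, the membership lemmas, the description of the faces of the
merged data (`faces_merge_filter_notMem`: the faces avoiding `m` are the faces inside `u`;
`faces_merge_filter_mem`: the faces through `m` are `insert m x`, `x ∈ Λ ∩ 𝒬`) and the counts
`|mergeT| = |T_u| + |P ∩ 𝒬|` (`card_mergeT`) and `|P ∩ 𝒬| = |P ∖ T_u| + |T_u ∩ 𝒬|`
(`card_inter_outFaces_eq`). The instance itself is MSTightMerge.lean.
-/

namespace PercRepro.MSTight

open Finset
open scoped FinsetFamily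

variable {α : Type*} [DecidableEq α] [Fintype α]

/-- The down-set of the merged instance on `insert m u`. -/
def mergeL (S u : Finset α) (L' : Finset (Finset α)) (m : α) : Finset (Finset α) :=
  (L'.filter fun w => w ⊆ u) ∪ (link (upSet S L') u).image (insert m)

/-- The family of the merged instance on `insert m u`. -/
def mergeT (T : Finset (Finset α)) (u : Finset α) (m : α) : Finset (Finset α) :=
  (T.filter fun y => y ⊆ u) ∪ ((T.image fun y => y ∩ u) ∩ outFaces T u).image (insert m)

/-- Membership in `mergeL`. -/
theorem mem_mergeL {S u w : Finset α} {L' : Finset (Finset α)} {m : α} :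
    w ∈ mergeL S u L' m ↔ (w ∈ L' ∧ w ⊆ u) ∨ ∃ x ∈ link (upSet S L') u, insert m x = w := by
  simp [mergeL]

/-- Membership in `mergeT`. -/
theorem mem_mergeT {u y : Finset α} {T : Finset (Finset α)} {m : α} :
    y ∈ mergeT T u m ↔ (y ∈ T ∧ y ⊆ u) ∨
      ∃ t, ((∃ y' ∈ T, y' ∩ u = t) ∧ t ∈ outFaces T u) ∧ insert m t = y := by
  simp [mergeT]

omit [Fintype α] in
/-- For `x ⊆ u ⊆ S`: `S \ (u \ x) = (S \ u) ∪ x`. -/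
theorem sdiff_sdiff_eq_sdiff_union {S u x : Finset α} (hxu : x ⊆ u) (huS : u ⊆ S) :
    S \ (u \ x) = (S \ u) ∪ x := by
  ext a
  simp only [mem_sdiff, mem_union, not_and, not_not]
  constructor
  · rintro ⟨haS, h⟩
    by_cases hau : a ∈ u
    · exact Or.inr (h hau)
    · exact Or.inl ⟨haS, hau⟩
  · rintro (⟨haS, hau⟩ | hax)
    · exact ⟨haS, fun h => absurd h hau⟩
    · exact ⟨huS (hxu hax), fun _ => hax⟩

/-- Membership in the link of an instance: `x ∈ Λ ↔ x ⊆ u ∧ (S \ u) ∪ x ∈ L'`. -/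
theorem mem_link_upSet {S u x : Finset α} {L' : Finset (Finset α)} (huS : u ⊆ S) :
    x ∈ link (upSet S L') u ↔ x ⊆ u ∧ (S \ u) ∪ x ∈ L' := by
  rw [mem_link, mem_upSet]
  constructor
  · rintro ⟨hxu, hx⟩
    rw [sdiff_sdiff_eq_sdiff_union hxu huS] at hx
    exact ⟨hxu, hx⟩
  · rintro ⟨hxu, hx⟩
    rw [sdiff_sdiff_eq_sdiff_union hxu huS]
    exact ⟨hxu, hx⟩

/-- Outside traces lie in `P ∩ 𝒬`. -/
theorem mem_inter_outFaces_of_mem_outTraces {u t : Finset α} {T : Finset (Finset α)}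
    (ht : t ∈ outTraces T u) : t ∈ (T.image fun y => y ∩ u) ∩ outFaces T u := by
  obtain ⟨y, hy, -, rfl⟩ := mem_outTraces.1 ht
  exact mem_inter.2 ⟨mem_image.2 ⟨y, hy, rfl⟩, mem_outFaces.2 ⟨_, ht, subset_refl _⟩⟩

/-- The trace of an outside member lies in `P ∩ 𝒬`. -/
theorem inter_mem_inter_outFaces {u y : Finset α} {T : Finset (Finset α)} (hy : y ∈ T)
    (hyu : ¬ y ⊆ u) : y ∩ u ∈ (T.image fun y => y ∩ u) ∩ outFaces T u :=
  mem_inter_outFaces_of_mem_outTraces (mem_outTraces.2 ⟨y, hy, hyu, rfl⟩)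

/-- Every set of `P ∩ 𝒬` is a trace. -/
theorem exists_of_mem_inter_outFaces {u t : Finset α} {T : Finset (Finset α)}
    (ht : t ∈ (T.image fun y => y ∩ u) ∩ outFaces T u) : ∃ y ∈ T, y ∩ u = t := by
  obtain ⟨y, hy, rfl⟩ := mem_image.1 (mem_inter.1 ht).1
  exact ⟨y, hy, rfl⟩

namespace RInst

variable {S u : Finset α} {L' T : Finset (Finset α)} {m : α}

/-- `∅ ∈ Λ`. -/
theorem empty_mem_link (h : RInst S L' T u) : (∅ : Finset α) ∈ link (upSet S L') u :=
  mem_link.2 ⟨empty_subset u, by rw [sdiff_empty]; exact h.mem_upSet_self⟩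

/-- `u ∉ Λ`. -/
theorem not_mem_link (h : RInst S L' T u) : u ∉ link (upSet S L') u := by
  intro hu
  rw [mem_link, Finset.sdiff_self, mem_upSet, sdiff_empty] at hu
  exact h.hS hu.2

/-- The members of `Λ` lie in `L'`. -/
theorem mem_of_mem_link (h : RInst S L' T u) {x : Finset α} (hx : x ∈ link (upSet S L') u) :
    x ∈ L' := by
  rw [mem_link_upSet h.huS] at hx
  exact h.hdown _ hx.2 _ subset_union_right

/-- The faces of the merged data avoiding `m` are the faces inside `u`. -/
theorem faces_merge_filter_notMem (hmu : m ∉ u) :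
    ((mergeL S u L' m).filter fun w => ∃ y ∈ mergeT T u m, w ⊆ y).filter (fun w => m ∉ w) =
      (L'.filter fun w => ∃ y ∈ T, w ⊆ y).filter fun w => w ⊆ u := by
  ext w
  simp only [mem_filter]
  constructor
  · rintro ⟨⟨hw, y, hy, hwy⟩, hmw⟩
    rcases mem_mergeL.1 hw with ⟨hwL, hwu⟩ | ⟨x, -, rfl⟩
    · refine ⟨⟨hwL, ?_⟩, hwu⟩
      rcases mem_mergeT.1 hy with ⟨hyT, -⟩ | ⟨t, ⟨⟨y', hy', rfl⟩, -⟩, rfl⟩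
      · exact ⟨y, hyT, hwy⟩
      · refine ⟨y', hy', fun a ha => ?_⟩
        have := hwy ha
        rw [mem_insert] at this
        rcases this with rfl | h'
        · exact absurd ha hmw
        · exact (mem_inter.1 h').1
    · exact absurd (mem_insert_self m x) hmw
  · rintro ⟨⟨hwL, y, hy, hwy⟩, hwu⟩
    refine ⟨⟨mem_mergeL.2 (Or.inl ⟨hwL, hwu⟩), ?_⟩, fun hm => hmu (hwu hm)⟩
    by_cases hyu : y ⊆ u
    · exact ⟨y, mem_mergeT.2 (Or.inl ⟨hy, hyu⟩), hwy⟩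
    · refine ⟨insert m (y ∩ u), mem_mergeT.2 (Or.inr ⟨y ∩ u,
        ⟨⟨y, hy, rfl⟩, (mem_inter.1 (inter_mem_inter_outFaces hy hyu)).2⟩, rfl⟩), ?_⟩
      exact (subset_inter hwy hwu).trans (subset_insert _ _)

/-- The faces of the merged data containing `m` are `insert m x` for `x ∈ Λ ∩ 𝒬`. -/
theorem faces_merge_filter_mem (hmu : m ∉ u) :
    ((mergeL S u L' m).filter fun w => ∃ y ∈ mergeT T u m, w ⊆ y).filter (fun w => m ∈ w) =
      (link (upSet S L') u ∩ outFaces T u).image (insert m) := by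
  ext w
  simp only [mem_filter, mem_image, mem_inter]
  constructor
  · rintro ⟨⟨hw, y, hy, hwy⟩, hmw⟩
    rcases mem_mergeL.1 hw with ⟨-, hwu⟩ | ⟨x, hx, rfl⟩
    · exact absurd (hwu hmw) hmu
    · refine ⟨x, ⟨hx, ?_⟩, rfl⟩
      have hxu : x ⊆ u := (mem_link.1 hx).1
      rcases mem_mergeT.1 hy with ⟨-, hyu⟩ | ⟨t, ⟨-, ht⟩, rfl⟩
      · exact absurd (hyu (hwy (mem_insert_self m x))) hmu
      · refine outFaces_downSet T u t ht x ?_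
        intro a ha
        have := hwy (mem_insert_of_mem ha)
        rw [mem_insert] at this
        rcases this with rfl | h'
        · exact absurd (hxu ha) hmu
        · exact h'
  · rintro ⟨x, ⟨hx, hxQ⟩, rfl⟩
    refine ⟨⟨mem_mergeL.2 (Or.inr ⟨x, hx, rfl⟩), ?_⟩, mem_insert_self m x⟩
    obtain ⟨t, ht, hxt⟩ := mem_outFaces.1 hxQ
    have ht' := mem_inter_outFaces_of_mem_outTraces ht
    obtain ⟨y, hy, rfl⟩ := exists_of_mem_inter_outFaces ht'
    refine ⟨insert m (y ∩ u), mem_mergeT.2 (Or.inr ⟨y ∩ u, ⟨⟨y, hy, rfl⟩, (mem_inter.1 ht').2⟩, rfl⟩),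
      insert_subset_insert m hxt⟩

/-- `|mergeT| = |T_u| + |P ∩ 𝒬|`. -/
theorem card_mergeT (hmu : m ∉ u) :
    (mergeT T u m).card = (T.filter fun y => y ⊆ u).card +
      ((T.image fun y => y ∩ u) ∩ outFaces T u).card := by
  rw [mergeT, card_union_of_disjoint, card_image_of_injOn]
  · intro t ht t' ht' h
    have htu : t ⊆ u := by
      obtain ⟨y, -, rfl⟩ := exists_of_mem_inter_outFaces (mem_coe.1 ht); exact inter_subset_right
    have ht'u : t' ⊆ u := by
      obtain ⟨y, -, rfl⟩ := exists_of_mem_inter_outFaces (mem_coe.1 ht'); exact inter_subset_right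
    have h1 : m ∉ t := fun h' => hmu (htu h')
    have h2 : m ∉ t' := fun h' => hmu (ht'u h')
    rw [← erase_insert h1, ← erase_insert h2, h]
  · rw [disjoint_left]
    intro y hy hy'
    obtain ⟨t, -, rfl⟩ := mem_image.1 hy'
    exact hmu ((mem_filter.1 hy).2 (mem_insert_self m t))

omit [Fintype α] in
/-- `T_u ⊆ P`. -/
theorem filter_subset_image_inter (T : Finset (Finset α)) (u : Finset α) :
    (T.filter fun y => y ⊆ u) ⊆ T.image fun y => y ∩ u := by
  intro y hy
  rw [mem_filter] at hy
  exact mem_image.2 ⟨y, hy.1, inter_eq_left.2 hy.2⟩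

/-- `P ∩ 𝒬 = (P \ T_u) ⊔ (T_u ∩ 𝒬)`: the count. -/
theorem card_inter_outFaces_eq (T : Finset (Finset α)) (u : Finset α) :
    ((T.image fun y => y ∩ u) ∩ outFaces T u).card =
      ((T.image fun y => y ∩ u) \ (T.filter fun y => y ⊆ u)).card +
        ((T.filter fun y => y ⊆ u) ∩ outFaces T u).card := by
  rw [← card_union_of_disjoint]
  · congr 1
    ext t
    simp only [mem_inter, mem_union, mem_sdiff]
    constructor
    · rintro ⟨hP, hQ⟩
      by_cases ht : t ∈ T.filter fun y => y ⊆ u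
      · exact Or.inr ⟨ht, hQ⟩
      · exact Or.inl ⟨hP, ht⟩
    · rintro (⟨hP, hnot⟩ | ⟨ht, hQ⟩)
      · refine ⟨hP, ?_⟩
        obtain ⟨y, hy, rfl⟩ := mem_image.1 hP
        have hyu : ¬ y ⊆ u := fun hyu => hnot (mem_filter.2 ⟨by rw [inter_eq_left.2 hyu]; exact hy,
          inter_subset_right⟩)
        exact (mem_inter.1 (inter_mem_inter_outFaces hy hyu)).2
      · exact ⟨filter_subset_image_inter T u ht, hQ⟩
  · exact disjoint_of_subset_right inter_subset_left sdiff_disjoint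

end RInst

end PercRepro.MSTight
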